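import Summits.QuantumFields.BalabanUV.Beta.SpineRecursive
import Summits.QuantumFields.BalabanUV.Beta.SpineRootedT2

/-!
# `BalabanUV.Beta.SpineRecursiveW` — binder row D1, (L4) piece (W-D): THE W-LITERAL OF THE RECURSIVE WALL FAMILY v2.26 —
# `SpureRecAt` (the unfolded first-order field tables), `T2RecAt` (the second-order field tables, typed RECURSIVELY over the wall's own
# step propagators `G_j`, NATIVE border placement), `WrecAt j := W2SymOfK G_j Lc (SpureRecAt j) (M1At j) (T2RecAt j) (M2Of mixFF j)`,
# their localisation / covariance, and the W-data package (β sub-cell, row BETA-an2 = BINDER-OWNERS row D1 OWNER, lineage an2 gen 17; (L4-D))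

Cell result of NEAR-MISS CELL 7 (Bałaban 4D lattice YM UV stability), β sub-cell.  HONEST FRAMING: discharging `BetaPertH` makes
Bałaban's UV stability UNCONDITIONAL — a real constructive-QFT result; it is NOT the continuum limit and NOT the Clay problem.  This file
asserts nothing about Bałaban's manuscripts: every declaration is a definition or a kernel-checked lemma about the definitions (no
`[cite:]`; placement under `Summits/` per the cell's (R34)).  It instantiates NO binder of the wall by itself.  NOT D1, NOT `BetaPertH`.

WHAT (design memo `SKELETON-D1-L4` v0 §1 / v1 §3 (W-D); an1 ACK (c1)(c2)(c3) journal l.8816; leaf-10's `LagrangeFold*` settles the Λ-slot).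
* §1 `e4OfKW Lc K S M W b b′ := mmRead Lc (K3OfK K Lc S M W b b′)` — an2's `BalabanStepW2.e4OfW` with the STRAIGHT `KInvStep Lc j` replaced by an
  ARBITRARY packed resolvent `K` (`e4OfKW_KInvStep`: `rfl` back); `e4OfKW_swap`, `locStencil₂_e4OfKW` (the proof of `locStencil₂_e4OfW`, `Decays K`
  as a binder), `e4OfKW_translate`.
* §2 `SpureRecAt ρ cE cVH cΛ j` — leaf-10's `WardLocusRecursive.SrecAt` MINUS its Lagrange piece: member `0` = `cE • wilsonA + cVH • vhSAt ρ` (NATIVE,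
  no `mfNeg`), member `j+1` = `(cE·wE (j+1)) • e3OfK Lc G_j (SrecAt ρ … j) + (cVH·wVH (j+1)) • vhSAt ρ` (the cubic sector reads the FOLDED `SrecAt j`,
  exactly as in `SrecAt (j+1)`); `SrecAt_eq_SpureRecAt_add_lam_zero/_succ` (the split, by `rfl`); `locStencil_SpureRecAt`, `SpureRecAt_translate`.
* §3 `T2RecAt` / `WrecAt`: member `0` of `T2RecAt` = `cE₂ • wilsonW₂ d T + cB • vh₂S` (NATIVE border — an1 (c3)); member `j+1` =
  `(cE₂·wV4 (j+1)) • e4OfKW Lc G_j (SpureRecAt j) (M1At ρ cΛ j) (WrecAt j) + (cB·wB2 (j+1)) • vh₂S`, where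
  **`WrecAt j := W2SymOfK G_j Lc (SpureRecAt j) (M1At ρ cΛ j) (T2RecAt j) (M2Of mixFF j)`**, `G_j = coDressKBmAt ρ Lc (KInvStep Lc j)`;
  `T2RecAt_succ`, `WrecAt_swap`, `T2RecAt_loc` + `vertexFamily₂_WrecAt'` (induction on `j`), `T2RecAt_translate` + `WrecAt_translate`.
* §4 the W-DATA PACKAGE for `SpineRecursive.JsRecBmAtOf`: `CwRecOf`, `δwRecOf`, `δwRecOf_pos`, `WrecAt_loc₂` (in-block root), and the literal
  **`JsRecWAtOf hLc hr cE cVH cΛ cE₂ cB T hB hmix := JsRecBmAtOf hLc hr cE cVH cΛ (WrecAt …) (CwRecOf …) (δwRecOf …) (δwRecOf_pos …) (WrecAt_loc₂ …)`**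
  (W instantiated; `T`, `vh₂S`, `mixFF`, the weights stay PARAMETERS — colour/units pins are the leads' (R45)/(P6), not decided here).
NOT HERE: the reflection law of `WrecAt` ((hWrC-rem) of `SpineRecursiveRemainder.…_closed_bcj_rem`), the locks (W-L), any identification (D1Tel).
-/

open Finset
open scoped BigOperators
open Literature.MathematicalPhysics.QuantumFieldTheory
open Literature.MathematicalPhysics.QuantumFieldTheory.Balaban1983to89
open Literature.MathematicalPhysics.QuantumFieldTheory.Balaban1983to89.Beta
open B12Sec2to5 (l1 l1_nonneg)
open ExpKernelCalculus (MKer Decays BiLoc VertexFamily VertexFamily₂ shiftK comp)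
open OneStepResolventKernel (Fib LocStencil JetData decays_mono biLoc_mono)
open AffineAveraging (box toSite)
open StepJetData (wilsonA locStencil_wilsonA wilsonA_translate locStencil_add locStencil_smul biLoc_smul)
open AveragingHessianKernels (ell)
open AveragingHessianKernelsRooted (vhSAt locStencil_vhSAt vhSAt_translate hessFFAt)
open InterLevelTransport (SLam)
open BalabanStepJets (lamCoeffOf locStencil_mono vertexFamily₂_mono)
open OneStepResolventKernel (KInv)
open OneStepKernelFamily (KInvStep decays_KInvStep shiftK_KInvStep)
open BalabanStepJetsSucc (mmRead E2 lamCoeffK wE wVH wΛ mmRead_shiftK_smul biLoc_mmRead l1_sub_le_l1_smul_sub)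
open BalabanCompositeJets (LocStencil₂)
open BalabanStepW2 (wM1 M2Of locStencilFM_M2Of M2Of_translate e4OfW wV4 wB2 K3OfK K3OfK_swap K3OfK_translate biLoc_K3OfK_far
  biLoc_le_mono biLoc_far_of_pair vertexFamily_mono' locStencil₂_smul' locStencil₂_add')
open SecondOrderResponse (W2SymOfK W2SymOfK_swap LocStencilFM vertexFamily₂_W2SymOfK' W2SymOfK_translate)
open WilsonBiStencil (wilsonW₂ wBound₂ biLoc_wilsonW₂ wilsonW₂_translate)
open AveragingContoursRooted (ctrOff ctrOff_mem_box)
open Summit.QuantumFields.BalabanUV.Beta.AxialDressingRooted (coDressKBmAt decays_coDressKBmAt_KInvStep shiftK_coDressKBmAt_KInvStep)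
open Summit.QuantumFields.BalabanUV.Beta.WardLocusRecursive (SrecAt SrecAt_zero SrecAt_succ locStencil_SrecAt SrecAt_translate)

noncomputable section

namespace Summit.QuantumFields.BalabanUV.Beta.SpineRooted

variable {d : ℕ}

/-! ## §1 The resolvent-generic fourth value jet `e4OfKW` -/

section E4

variable (Lc : ℕ)

/-- [folklore] **THE RESOLVENT-GENERIC SECOND BOND-DERIVATIVE READ-OUT** `e4OfKW Lc K S M W b b′ := mmRead Lc (K3OfK K Lc S M W b b′)` — an2's
`BalabanStepW2.e4OfW` with an ARBITRARY packed resolvent `K` in place of `KInvStep Lc j`.  A definition asserting nothing. -/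
def e4OfKW (K : MKer (d + 1) (Fib d)) (S M : Fin (d + 1) → (Fin (d + 1) → ℤ) → MKer (d + 1) (Fib d))
    (W : Fin (d + 1) → (Fin (d + 1) → ℤ) → Fin (d + 1) → (Fin (d + 1) → ℤ) → MKer (d + 1) (Fib d))
    (μ : Fin (d + 1)) (y : Fin (d + 1) → ℤ) (ν : Fin (d + 1)) (y' : Fin (d + 1) → ℤ) : MKer (d + 1) (Fib d) :=
  mmRead Lc (K3OfK K Lc S M W μ y ν y')

variable {Lc}

/-- [folklore] Through the straight step resolvent `e4OfKW` IS `e4OfW` (`rfl`). -/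
theorem e4OfKW_KInvStep [NeZero Lc] (j : ℕ) (S M : Fin (d + 1) → (Fin (d + 1) → ℤ) → MKer (d + 1) (Fib d))
    (W : Fin (d + 1) → (Fin (d + 1) → ℤ) → Fin (d + 1) → (Fin (d + 1) → ℤ) → MKer (d + 1) (Fib d)) :
    e4OfKW Lc (KInvStep (d := d) Lc j) S M W = e4OfW d Lc j S M W := rfl

/-- [folklore] `e4OfKW` is symmetric under `(μ, y) ↔ (ν, y′)` when `W` is. -/
theorem e4OfKW_swap (K : MKer (d + 1) (Fib d)) (S M : Fin (d + 1) → (Fin (d + 1) → ℤ) → MKer (d + 1) (Fib d))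
    {W : Fin (d + 1) → (Fin (d + 1) → ℤ) → Fin (d + 1) → (Fin (d + 1) → ℤ) → MKer (d + 1) (Fib d)}
    (hW : ∀ μ y ν y', W ν y' μ y = W μ y ν y') (μ : Fin (d + 1)) (y : Fin (d + 1) → ℤ) (ν : Fin (d + 1)) (y' : Fin (d + 1) → ℤ) :
    e4OfKW Lc K S M W ν y' μ y = e4OfKW Lc K S M W μ y ν y' := by
  unfold e4OfKW
  rw [K3OfK_swap K Lc S M hW]

/-- [folklore] **`e4OfKW Lc K S M W` IS A `LocStencil₂` FAMILY** for a decaying `K` (the proof of `BalabanStepW2.locStencil₂_e4OfW` verbatim with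
the decay of `K` as a binder). -/
theorem locStencil₂_e4OfKW [NeZero Lc] (hLc : 1 ≤ Lc) {K : MKer (d + 1) (Fib d)} (hK : ∃ δ C : ℝ, 0 < δ ∧ 0 ≤ C ∧ Decays K C δ)
    {S : Fin (d + 1) → (Fin (d + 1) → ℤ) → MKer (d + 1) (Fib d)} (hS : ∃ Cs δ : ℝ, 0 < δ ∧ LocStencil S Cs δ)
    {M : Fin (d + 1) → (Fin (d + 1) → ℤ) → MKer (d + 1) (Fib d)} (hM : ∃ CM δ : ℝ, 0 < δ ∧ VertexFamily M Lc CM δ)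
    {W : Fin (d + 1) → (Fin (d + 1) → ℤ) → Fin (d + 1) → (Fin (d + 1) → ℤ) → MKer (d + 1) (Fib d)}
    (hW : ∃ Cw δ : ℝ, 0 < δ ∧ VertexFamily₂ W Lc Cw δ) (hWs : ∀ μ y ν y', W ν y' μ y = W μ y ν y') :
    ∃ C δ : ℝ, 0 < δ ∧ LocStencil₂ (e4OfKW Lc K S M W) C δ := by
  obtain ⟨δK, CK, hδK, hCK, hK⟩ := hK
  obtain ⟨Cs, δs, hδs, hS⟩ := hS
  obtain ⟨CM, δM, hδM, hM⟩ := hM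
  obtain ⟨Cw, δw, hδw, hW⟩ := hW
  have hCs : 0 ≤ Cs := (hS 0 0).nonneg (Sum.inl 0)
  have hCM : 0 ≤ CM := (hM 0 0).nonneg (Sum.inl 0)
  have hCw : 0 ≤ Cw := (hW 0 0 0 0).nonneg (Sum.inl 0)
  obtain ⟨m, hm, hmK, hms, hmM, hmw⟩ : ∃ m : ℝ, 0 < m ∧ m ≤ δK ∧ m ≤ δs ∧ m ≤ δM ∧ m ≤ δw / 4 :=
    ⟨min (min δK δs) (min δM (δw / 4)), lt_min (lt_min hδK hδs) (lt_min hδM (by positivity)),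
      (min_le_left _ _).trans (min_le_left _ _), (min_le_left _ _).trans (min_le_right _ _),
      (min_le_right _ _).trans (min_le_left _ _), (min_le_right _ _).trans (min_le_right _ _)⟩
  have hKm : Decays K CK m := decays_mono hK hCK le_rfl hmK
  have hSm : LocStencil S Cs m := locStencil_mono hS hCs hms
  have hMm : VertexFamily M Lc CM m := vertexFamily_mono' hM hCM hmM
  have hWm : ∀ (μ : Fin (d + 1)) (y : Fin (d + 1) → ℤ) (ν : Fin (d + 1)) (y' : Fin (d + 1) → ℤ),
      BiLoc (W μ y ν y') ((Lc : ℤ) • y) ((Lc : ℤ) • y) (Cw * Real.exp (-m * l1 ((Lc : ℤ) • y' - (Lc : ℤ) • y))) m := by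
    intro μ y ν y'
    have h2 : BiLoc (W μ y ν y') ((Lc : ℤ) • y') ((Lc : ℤ) • y) Cw δw := by
      rw [← hWs μ y ν y']
      exact hW ν y' μ y
    refine biLoc_le_mono (biLoc_far_of_pair (hW μ y ν y') h2 hδw.le) (by positivity) ?_ hmw
    exact mul_le_mul_of_nonneg_left (Real.exp_le_exp.2 (by nlinarith [l1_nonneg ((Lc : ℤ) • y' - (Lc : ℤ) • y)])) hCw
  obtain ⟨C₃, hC₃, h3⟩ := biLoc_K3OfK_far hKm hCK hm hSm hMm hCw hWm
  refine ⟨C₃, m / 32, by positivity, fun κ u κ' u' => ?_⟩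
  have h' : BiLoc (K3OfK K Lc S M W κ u κ' u') ((Lc : ℤ) • u) ((Lc : ℤ) • u) (C₃ * Real.exp (-(m / 32) * l1 (u' - u))) (m / 32) := by
    refine biLoc_le_mono (h3 κ u κ' u') (by positivity) ?_ le_rfl
    exact mul_le_mul_of_nonneg_left (Real.exp_le_exp.2 (by nlinarith [l1_sub_le_l1_smul_sub hLc u' u])) hC₃
  exact biLoc_mmRead hLc h' (by positivity)

/-- [folklore] **COVARIANCE OF `e4OfKW`** under all translations of the coarse lattice, for a block-covariant `K` (`K3OfK_translate`, `mmRead_shiftK_smul`). -/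
theorem e4OfKW_translate [NeZero Lc] {K : MKer (d + 1) (Fib d)} (hKs : ∀ t, shiftK (-((Lc : ℤ) • t)) K = K)
    {S M : Fin (d + 1) → (Fin (d + 1) → ℤ) → MKer (d + 1) (Fib d)}
    (hS : ∀ (κ : Fin (d + 1)) (u t : Fin (d + 1) → ℤ), S κ (u + (Lc : ℤ) • t) = shiftK (-((Lc : ℤ) • t)) (S κ u))
    (hM : ∀ (ρ : Fin (d + 1)) (w t : Fin (d + 1) → ℤ), M ρ (w + t) = shiftK (-((Lc : ℤ) • t)) (M ρ w))
    {W : Fin (d + 1) → (Fin (d + 1) → ℤ) → Fin (d + 1) → (Fin (d + 1) → ℤ) → MKer (d + 1) (Fib d)}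
    (hWt : ∀ (μ : Fin (d + 1)) (y : Fin (d + 1) → ℤ) (ν : Fin (d + 1)) (y' t : Fin (d + 1) → ℤ),
      W μ (y + t) ν (y' + t) = shiftK (-((Lc : ℤ) • t)) (W μ y ν y'))
    (μ : Fin (d + 1)) (y : Fin (d + 1) → ℤ) (ν : Fin (d + 1)) (y' t : Fin (d + 1) → ℤ) :
    e4OfKW Lc K S M W μ (y + t) ν (y' + t) = shiftK (-t) (e4OfKW Lc K S M W μ y ν y') := by
  unfold e4OfKW
  rw [K3OfK_translate hKs hS hM hWt, mmRead_shiftK_smul]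

end E4

/-! ## §2 The unfolded first-order field tables `SpureRecAt` -/

section Pure

variable (d) (Lc : ℕ) [NeZero Lc]

/-- [our object, (L4-D)] **THE UNFOLDED FIRST-ORDER FIELD TABLES OF THE RECURSIVE WALL FAMILY**: `SrecAt ρ … j` minus its Lagrange piece —
member `0` = `cE • wilsonA + cVH • vhSAt ρ` (NATIVE placement), member `j+1` = `(cE·wE (j+1)) • e3OfK Lc G_j (SrecAt ρ … j) + (cVH·wVH (j+1)) • vhSAt ρ`. -/
def SpureRecAt (ρ : Fin (d + 1) → ℤ) (cE cVH cΛ : ℝ) : ℕ → Fin (d + 1) → (Fin (d + 1) → ℤ) → MKer (d + 1) (Fib d)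
  | 0 => fun κ' u' => cE • wilsonA d κ' u' + cVH • vhSAt ρ d Lc rfl κ' u'
  | j + 1 => fun κ' u' =>
      (cE * wE d Lc (j + 1)) • e3OfK Lc (coDressKBmAt ρ Lc (KInvStep (d := d) Lc j)) (SrecAt d Lc ρ cE cVH cΛ j) κ' u' +
        (cVH * wVH d Lc (j + 1)) • vhSAt ρ d Lc rfl κ' u'

variable {d Lc}

/-- [folklore] Member `0`. -/
@[simp] theorem SpureRecAt_zero_level (ρ : Fin (d + 1) → ℤ) (cE cVH cΛ : ℝ) :
    SpureRecAt d Lc ρ cE cVH cΛ 0 = fun κ' u' => cE • wilsonA d κ' u' + cVH • vhSAt ρ d Lc rfl κ' u' := rfl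
/-- [folklore] Member `j+1`. -/
@[simp] theorem SpureRecAt_succ (ρ : Fin (d + 1) → ℤ) (cE cVH cΛ : ℝ) (j : ℕ) :
    SpureRecAt d Lc ρ cE cVH cΛ (j + 1) = fun κ' u' =>
      (cE * wE d Lc (j + 1)) • e3OfK Lc (coDressKBmAt ρ Lc (KInvStep (d := d) Lc j)) (SrecAt d Lc ρ cE cVH cΛ j) κ' u' +
        (cVH * wVH d Lc (j + 1)) • vhSAt ρ d Lc rfl κ' u' := rfl
/-- [folklore] **THE Λ-SPLIT AT LEVEL `0`**: `SrecAt 0 = SpureRecAt 0 + cΛ • SLam Lc (lamCoeffOf KInv Lc) hessFFAt` (`rfl`). -/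
theorem SrecAt_eq_SpureRecAt_add_lam_zero (ρ : Fin (d + 1) → ℤ) (cE cVH cΛ : ℝ) (κ' : Fin (d + 1)) (u' : Fin (d + 1) → ℤ) :
    SrecAt d Lc ρ cE cVH cΛ 0 κ' u' = SpureRecAt d Lc ρ cE cVH cΛ 0 κ' u' +
      cΛ • SLam Lc (lamCoeffOf (KInv (N := Lc) (d := d)) Lc) (fun μ y => hessFFAt ρ Lc μ y) κ' u' := rfl

/-- [folklore] **THE Λ-SPLIT AT LEVEL `j+1`**: `SrecAt (j+1) = SpureRecAt (j+1) + (cΛ·wΛ (j+1)) • SLam Lc (lamCoeffK (KInvStep Lc (j+1)) (E2 (j+1)) Lc) hessFFAt`. -/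
theorem SrecAt_eq_SpureRecAt_add_lam_succ (ρ : Fin (d + 1) → ℤ) (cE cVH cΛ : ℝ) (j : ℕ) (κ' : Fin (d + 1)) (u' : Fin (d + 1) → ℤ) :
    SrecAt d Lc ρ cE cVH cΛ (j + 1) κ' u' = SpureRecAt d Lc ρ cE cVH cΛ (j + 1) κ' u' +
      (cΛ * wΛ d Lc (j + 1)) • SLam Lc (lamCoeffK (KInvStep (d := d) Lc (j + 1)) (E2 d Lc (j + 1)) Lc) (fun μ y => hessFFAt ρ Lc μ y) κ' u' :=
  rfl
/-- [folklore] **EVERY MEMBER OF `SpureRecAt (toSite r)` IS A LOCAL STENCIL FAMILY** (in-block root): level `0` from `locStencil_wilsonA`,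
`locStencil_vhSAt`; level `j+1` from `locStencil_e3OfK` (decay of `G_j`) over leaf-10's `locStencil_SrecAt j`, plus the border. -/
theorem locStencil_SpureRecAt (hLc : 1 ≤ Lc) {r : Fin (d + 1) → ℕ} (hr : r ∈ box (d + 1) Lc) (cE cVH cΛ : ℝ) :
    ∀ j : ℕ, ∃ Cs δ : ℝ, 0 < δ ∧ LocStencil (SpureRecAt d Lc (toSite r) cE cVH cΛ j) Cs δ
  | 0 => by
    have h1 : LocStencil (wilsonA d) (StepJetData.wBound d * Real.exp (4 * 1)) 1 := locStencil_wilsonA zero_le_one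
    have h2 : LocStencil (vhSAt (toSite r) d Lc rfl) (3 * (ell (d + 1) Lc : ℝ) ^ 2 * Real.exp (4 * ((d : ℝ) + 1) * Lc * 1)) 1 :=
      locStencil_vhSAt hLc hr zero_le_one
    exact ⟨_, 1, one_pos, fun κ' u' => by
      rw [SpureRecAt_zero_level]
      exact (locStencil_add (locStencil_smul cE h1) (locStencil_smul cVH h2)) κ' u'⟩
  | j + 1 => by
    obtain ⟨Cs, δs, hδs, hS⟩ := locStencil_SrecAt (d := d) (Lc := Lc) hLc hr cE cVH cΛ j
    obtain ⟨C₁, δ₁, hδ₁, h1⟩ := locStencil_e3OfK (N := Lc) hLc (decays_coDressKBmAt_KInvStep (d := d) hr j) hS hδs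
    have hC₁ : 0 ≤ C₁ := (h1 0 0).nonneg (Sum.inl 0)
    set r' : ℝ := min δ₁ 1 with hr'
    have hr0 : 0 < r' := lt_min hδ₁ one_pos
    have h1r : LocStencil (e3OfK Lc (coDressKBmAt (toSite r) Lc (KInvStep (d := d) Lc j)) (SrecAt d Lc (toSite r) cE cVH cΛ j)) C₁ r' :=
      locStencil_mono h1 hC₁ (min_le_left _ _)
    have h2r : LocStencil (vhSAt (toSite r) d Lc rfl) (3 * (ell (d + 1) Lc : ℝ) ^ 2 * Real.exp (4 * ((d : ℝ) + 1) * Lc * r')) r' :=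
      locStencil_vhSAt hLc hr hr0.le
    exact ⟨_, r', hr0, fun κ' u' => by
      rw [SpureRecAt_succ]
      exact (locStencil_add (locStencil_smul (cE * wE d Lc (j + 1)) h1r) (locStencil_smul (cVH * wVH d Lc (j + 1)) h2r)) κ' u'⟩

/-- [folklore] **(St♭) FOR EVERY MEMBER OF `SpureRecAt ρ`** (block translations, any root). -/
theorem SpureRecAt_translate (ρ : Fin (d + 1) → ℤ) (hLc : 1 ≤ Lc) (cE cVH cΛ : ℝ) :
    ∀ (j : ℕ) (κ' : Fin (d + 1)) (u t : Fin (d + 1) → ℤ),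
      SpureRecAt d Lc ρ cE cVH cΛ j κ' (u + (Lc : ℤ) • t) = shiftK (-((Lc : ℤ) • t)) (SpureRecAt d Lc ρ cE cVH cΛ j κ' u)
  | 0, κ', u, t => by
    have h1 := wilsonA_translate (d := d) κ' u ((Lc : ℤ) • t)
    have h2 := vhSAt_translate (d := d) ρ hLc κ' u t
    funext x z a b
    simp only [SpureRecAt_zero_level, Pi.add_apply, Pi.smul_apply, smul_eq_mul, shiftK]
    rw [h1, h2]
    rfl
  | j + 1, κ', u, t => by
    have h1 := e3OfK_translate (N := Lc) (K := coDressKBmAt ρ Lc (KInvStep (d := d) Lc j))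
      (shiftK_coDressKBmAt_KInvStep (d := d) ρ j) (S := SrecAt d Lc ρ cE cVH cΛ j) (SrecAt_translate ρ hLc cE cVH cΛ j) κ' u
      ((Lc : ℤ) • t)
    have h2 := vhSAt_translate (d := d) ρ hLc κ' u t
    funext x z a b
    simp only [SpureRecAt_succ, Pi.add_apply, Pi.smul_apply, smul_eq_mul, shiftK]
    rw [h1, h2]
    rfl

end Pure

/-! ## §3 The recursively typed second-order tables `T2RecAt` and the W-literal `WrecAt` -/

section W

variable (d) (Lc : ℕ) [NeZero Lc]

/-- [our object, (L4-D)] **THE RECURSIVELY TYPED SECOND-ORDER FIELD TABLES**: member `0` = `cE₂ • wilsonW₂ d T + cB • vh₂S` (NATIVE border);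
member `j+1` = `(cE₂·wV4 (j+1)) • e4OfKW Lc G_j (SpureRecAt j) (M1At ρ cΛ j) (W2SymOfK G_j Lc (SpureRecAt j) (M1At ρ cΛ j) (T2RecAt j) (M2Of mixFF j))
+ (cB·wB2 (j+1)) • vh₂S` (structural recursion; `G_j = coDressKBmAt ρ Lc (KInvStep Lc j)`).  A definition asserting nothing. -/
def T2RecAt (ρ : Fin (d + 1) → ℤ) (cE cVH cΛ cE₂ cB : ℝ) (T : Fin 4 → Fin 4 → Fin 4 → Fin 4 → ℝ)
    (vh₂S mixFF : Fin (d + 1) → (Fin (d + 1) → ℤ) → Fin (d + 1) → (Fin (d + 1) → ℤ) → MKer (d + 1) (Fib d)) :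
    ℕ → Fin (d + 1) → (Fin (d + 1) → ℤ) → Fin (d + 1) → (Fin (d + 1) → ℤ) → MKer (d + 1) (Fib d)
  | 0 => fun κ u κ' u' => cE₂ • wilsonW₂ d T κ u κ' u' + cB • vh₂S κ u κ' u'
  | j + 1 => fun κ u κ' u' =>
      (cE₂ * wV4 d Lc (j + 1)) •
          e4OfKW Lc (coDressKBmAt ρ Lc (KInvStep (d := d) Lc j)) (SpureRecAt d Lc ρ cE cVH cΛ j) (M1At d Lc ρ cΛ j)
            (W2SymOfK (coDressKBmAt ρ Lc (KInvStep (d := d) Lc j)) Lc (SpureRecAt d Lc ρ cE cVH cΛ j) (M1At d Lc ρ cΛ j)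
              (T2RecAt ρ cE cVH cΛ cE₂ cB T vh₂S mixFF j) (M2Of d Lc mixFF j)) κ u κ' u'
        + (cB * wB2 d Lc (j + 1)) • vh₂S κ u κ' u'

/-- [our object, (L4-D)] **THE W-LITERAL OF THE RECURSIVE WALL FAMILY**: `WrecAt … j := W2SymOfK G_j Lc (SpureRecAt j) (M1At ρ cΛ j) (T2RecAt j) (M2Of mixFF j)`. -/
def WrecAt (ρ : Fin (d + 1) → ℤ) (cE cVH cΛ cE₂ cB : ℝ) (T : Fin 4 → Fin 4 → Fin 4 → Fin 4 → ℝ)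
    (vh₂S mixFF : Fin (d + 1) → (Fin (d + 1) → ℤ) → Fin (d + 1) → (Fin (d + 1) → ℤ) → MKer (d + 1) (Fib d)) (j : ℕ) :
    Fin (d + 1) → (Fin (d + 1) → ℤ) → Fin (d + 1) → (Fin (d + 1) → ℤ) → MKer (d + 1) (Fib d) :=
  W2SymOfK (coDressKBmAt ρ Lc (KInvStep (d := d) Lc j)) Lc (SpureRecAt d Lc ρ cE cVH cΛ j) (M1At d Lc ρ cΛ j)
    (T2RecAt d Lc ρ cE cVH cΛ cE₂ cB T vh₂S mixFF j) (M2Of d Lc mixFF j)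

variable {d Lc}
variable (ρ : Fin (d + 1) → ℤ) (cE cVH cΛ cE₂ cB : ℝ) (T : Fin 4 → Fin 4 → Fin 4 → Fin 4 → ℝ)
  (vh₂S mixFF : Fin (d + 1) → (Fin (d + 1) → ℤ) → Fin (d + 1) → (Fin (d + 1) → ℤ) → MKer (d + 1) (Fib d))

/-- [folklore] Member `0` of `T2RecAt`. -/
@[simp] theorem T2RecAt_zero_level : T2RecAt d Lc ρ cE cVH cΛ cE₂ cB T vh₂S mixFF 0 =
    fun κ u κ' u' => cE₂ • wilsonW₂ d T κ u κ' u' + cB • vh₂S κ u κ' u' := rfl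

/-- [folklore] Member `j+1` of `T2RecAt` THROUGH `WrecAt … j` (`rfl`). -/
theorem T2RecAt_succ (j : ℕ) : T2RecAt d Lc ρ cE cVH cΛ cE₂ cB T vh₂S mixFF (j + 1) = fun κ u κ' u' =>
    (cE₂ * wV4 d Lc (j + 1)) • e4OfKW Lc (coDressKBmAt ρ Lc (KInvStep (d := d) Lc j)) (SpureRecAt d Lc ρ cE cVH cΛ j) (M1At d Lc ρ cΛ j)
        (WrecAt d Lc ρ cE cVH cΛ cE₂ cB T vh₂S mixFF j) κ u κ' u' + (cB * wB2 d Lc (j + 1)) • vh₂S κ u κ' u' := rfl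

/-- [folklore] **SWAP SYMMETRY** of every `WrecAt … j` (`W2SymOfK_swap`) — an1's condition (c2) for the symmetrised literal. -/
theorem WrecAt_swap (j : ℕ) (μ : Fin (d + 1)) (y : Fin (d + 1) → ℤ) (ν : Fin (d + 1)) (y' : Fin (d + 1) → ℤ) :
    WrecAt d Lc ρ cE cVH cΛ cE₂ cB T vh₂S mixFF j ν y' μ y = WrecAt d Lc ρ cE cVH cΛ cE₂ cB T vh₂S mixFF j μ y ν y' :=
  W2SymOfK_swap _ _ _ _ _ _ μ y ν y'

/-- [folklore] **`WrecAt (toSite r) … j` IS A SECOND-ORDER VERTEX FAMILY** once `T2RecAt … j` is a `LocStencil₂` family (in-block root;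
`vertexFamily₂_W2SymOfK'` with `decays_coDressKBmAt_KInvStep`, `locStencil_SpureRecAt`, `vertexFamily_M1At`, `locStencilFM_M2Of`). -/
theorem vertexFamily₂_WrecAt_of (hLc : 1 ≤ Lc) {r : Fin (d + 1) → ℕ} (hr : r ∈ box (d + 1) Lc)
    (hmix : ∃ C δ : ℝ, 0 < δ ∧ LocStencilFM Lc mixFF C δ) (j : ℕ)
    (hT : ∃ C δ : ℝ, 0 < δ ∧ LocStencil₂ (T2RecAt d Lc (toSite r) cE cVH cΛ cE₂ cB T vh₂S mixFF j) C δ) :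
    ∃ Cw δw : ℝ, 0 < δw ∧ VertexFamily₂ (WrecAt d Lc (toSite r) cE cVH cΛ cE₂ cB T vh₂S mixFF j) Lc Cw δw := by
  obtain ⟨Cs, δs, hδs, hS⟩ := locStencil_SpureRecAt (d := d) (Lc := Lc) hLc hr cE cVH cΛ j
  obtain ⟨C₂, δ₂, hδ₂, hT₂⟩ := hT
  obtain ⟨CM₂, δ₃, hδ₃, hM₂⟩ := hmix
  exact vertexFamily₂_W2SymOfK' (decays_coDressKBmAt_KInvStep (d := d) hr j) hS hδs (vertexFamily_M1At hLc hr cΛ j zero_le_one) one_pos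
    hT₂ hδ₂ (locStencilFM_M2Of hM₂ j) hδ₃

/-- [folklore] **EVERY MEMBER OF `T2RecAt (toSite r)` IS A `LocStencil₂` FAMILY** (in-block root; rate existential per level), by induction on `j`
(`locStencil₂_e4OfKW` over `G_j` + the border). -/
theorem T2RecAt_loc (hLc : 1 ≤ Lc) {r : Fin (d + 1) → ℕ} (hr : r ∈ box (d + 1) Lc) (hB : ∃ C δ : ℝ, 0 < δ ∧ LocStencil₂ vh₂S C δ)
    (hmix : ∃ C δ : ℝ, 0 < δ ∧ LocStencilFM Lc mixFF C δ) :
    ∀ j : ℕ, ∃ C δ : ℝ, 0 < δ ∧ LocStencil₂ (T2RecAt d Lc (toSite r) cE cVH cΛ cE₂ cB T vh₂S mixFF j) C δ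
  | 0 => by
    obtain ⟨CB, δB, hδB, hBl⟩ := hB
    have hWil : LocStencil₂ (wilsonW₂ d T) (wBound₂ d T * Real.exp (8 * δB)) δB := fun κ u κ' u' => biLoc_wilsonW₂ T hδB.le κ u κ' u'
    rw [T2RecAt_zero_level]
    exact ⟨_, δB, hδB, locStencil₂_add' (locStencil₂_smul' cE₂ hWil) (locStencil₂_smul' cB hBl)⟩
  | j + 1 => by
    have hT := T2RecAt_loc hLc hr hB hmix j
    obtain ⟨CB, δB, hδB, hBl⟩ := hB
    have hWv := vertexFamily₂_WrecAt_of cE cVH cΛ cE₂ cB T vh₂S mixFF hLc hr hmix j hT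
    obtain ⟨C4, δ4, hδ4, h4⟩ := locStencil₂_e4OfKW (d := d) (Lc := Lc) hLc (decays_coDressKBmAt_KInvStep (d := d) hr j)
      (locStencil_SpureRecAt hLc hr cE cVH cΛ j) ⟨_, 1, one_pos, vertexFamily_M1At hLc hr cΛ j zero_le_one⟩ hWv
      (WrecAt_swap (toSite r) cE cVH cΛ cE₂ cB T vh₂S mixFF j)
    have hm : 0 < min δ4 δB := lt_min hδ4 hδB
    rw [T2RecAt_succ]
    exact ⟨_, _, hm, locStencil₂_add' (locStencil₂_smul' _ (h4.mono (min_le_left δ4 δB)))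
      (locStencil₂_smul' _ (hBl.mono (min_le_right δ4 δB)))⟩

/-- [folklore] **`WrecAt (toSite r) … j` IS A SECOND-ORDER VERTEX FAMILY** (in-block root; some positive rate). -/
theorem vertexFamily₂_WrecAt' (hLc : 1 ≤ Lc) {r : Fin (d + 1) → ℕ} (hr : r ∈ box (d + 1) Lc) (hB : ∃ C δ : ℝ, 0 < δ ∧ LocStencil₂ vh₂S C δ)
    (hmix : ∃ C δ : ℝ, 0 < δ ∧ LocStencilFM Lc mixFF C δ) (j : ℕ) :
    ∃ Cw δw : ℝ, 0 < δw ∧ VertexFamily₂ (WrecAt d Lc (toSite r) cE cVH cΛ cE₂ cB T vh₂S mixFF j) Lc Cw δw :=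
  vertexFamily₂_WrecAt_of cE cVH cΛ cE₂ cB T vh₂S mixFF hLc hr hmix j (T2RecAt_loc cE cVH cΛ cE₂ cB T vh₂S mixFF hLc hr hB hmix j)

/-- [folklore] **JOINT BLOCK COVARIANCE OF `T2RecAt ρ` AND (Wt) OF `WrecAt ρ`** (any root), by simultaneous induction on `j`
(`wilsonW₂_translate`, the binders' covariance, `e4OfKW_translate` over the `Lc`-periodic `G_j`, `W2SymOfK_translate`). -/
theorem T2RecAt_translate (hLc : 1 ≤ Lc)
    (hBt : ∀ (κ : Fin (d + 1)) (u : Fin (d + 1) → ℤ) (κ' : Fin (d + 1)) (u' t : Fin (d + 1) → ℤ),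
      vh₂S κ (u + (Lc : ℤ) • t) κ' (u' + (Lc : ℤ) • t) = shiftK (-((Lc : ℤ) • t)) (vh₂S κ u κ' u'))
    (hmixt : ∀ (κ : Fin (d + 1)) (u : Fin (d + 1) → ℤ) (μ : Fin (d + 1)) (w t : Fin (d + 1) → ℤ),
      mixFF κ (u + (Lc : ℤ) • t) μ (w + t) = shiftK (-((Lc : ℤ) • t)) (mixFF κ u μ w)) :
    ∀ (j : ℕ) (κ : Fin (d + 1)) (u : Fin (d + 1) → ℤ) (κ' : Fin (d + 1)) (u' t : Fin (d + 1) → ℤ),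
      T2RecAt d Lc ρ cE cVH cΛ cE₂ cB T vh₂S mixFF j κ (u + (Lc : ℤ) • t) κ' (u' + (Lc : ℤ) • t)
        = shiftK (-((Lc : ℤ) • t)) (T2RecAt d Lc ρ cE cVH cΛ cE₂ cB T vh₂S mixFF j κ u κ' u')
  | 0, κ, u, κ', u', t => by
    show cE₂ • wilsonW₂ d T κ (u + (Lc : ℤ) • t) κ' (u' + (Lc : ℤ) • t) + cB • vh₂S κ (u + (Lc : ℤ) • t) κ' (u' + (Lc : ℤ) • t)
      = shiftK (-((Lc : ℤ) • t)) (cE₂ • wilsonW₂ d T κ u κ' u' + cB • vh₂S κ u κ' u')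
    rw [wilsonW₂_translate, hBt]
    rfl
  | j + 1, κ, u, κ', u', t => by
    have IH := T2RecAt_translate hLc hBt hmixt j
    have hWt : ∀ (μ : Fin (d + 1)) (y : Fin (d + 1) → ℤ) (ν : Fin (d + 1)) (y' s : Fin (d + 1) → ℤ),
        WrecAt d Lc ρ cE cVH cΛ cE₂ cB T vh₂S mixFF j μ (y + s) ν (y' + s) = shiftK (-((Lc : ℤ) • s)) (WrecAt d Lc ρ cE cVH cΛ cE₂ cB T vh₂S mixFF j μ y ν y') :=
      fun μ y ν y' s => W2SymOfK_translate (N := Lc) (shiftK_coDressKBmAt_KInvStep (d := d) ρ j)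
        (SpureRecAt_translate ρ hLc cE cVH cΛ j) (M1At_translate (Lc := Lc) ρ cΛ j) IH (M2Of_translate (Lc := Lc) hmixt j) μ y ν y' s
    rw [T2RecAt_succ]
    show (cE₂ * wV4 d Lc (j + 1)) • e4OfKW Lc (coDressKBmAt ρ Lc (KInvStep (d := d) Lc j)) (SpureRecAt d Lc ρ cE cVH cΛ j) (M1At d Lc ρ cΛ j)
          (WrecAt d Lc ρ cE cVH cΛ cE₂ cB T vh₂S mixFF j) κ (u + (Lc : ℤ) • t) κ' (u' + (Lc : ℤ) • t)
        + (cB * wB2 d Lc (j + 1)) • vh₂S κ (u + (Lc : ℤ) • t) κ' (u' + (Lc : ℤ) • t)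
      = shiftK (-((Lc : ℤ) • t)) ((cE₂ * wV4 d Lc (j + 1)) •
          e4OfKW Lc (coDressKBmAt ρ Lc (KInvStep (d := d) Lc j)) (SpureRecAt d Lc ρ cE cVH cΛ j) (M1At d Lc ρ cΛ j)
            (WrecAt d Lc ρ cE cVH cΛ cE₂ cB T vh₂S mixFF j) κ u κ' u' + (cB * wB2 d Lc (j + 1)) • vh₂S κ u κ' u')
    rw [e4OfKW_translate (shiftK_coDressKBmAt_KInvStep (d := d) ρ j) (SpureRecAt_translate ρ hLc cE cVH cΛ j) (M1At_translate (Lc := Lc) ρ cΛ j) hWt,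
      hBt]
    rfl

/-- [folklore] **(Wt) OF THE W-LITERAL**: `WrecAt ρ … j μ (y + t) ν (y′ + t) = shiftK (−Lc•t) (WrecAt ρ … j μ y ν y′)` (any root). -/
theorem WrecAt_translate (hLc : 1 ≤ Lc)
    (hBt : ∀ (κ : Fin (d + 1)) (u : Fin (d + 1) → ℤ) (κ' : Fin (d + 1)) (u' t : Fin (d + 1) → ℤ),
      vh₂S κ (u + (Lc : ℤ) • t) κ' (u' + (Lc : ℤ) • t) = shiftK (-((Lc : ℤ) • t)) (vh₂S κ u κ' u'))
    (hmixt : ∀ (κ : Fin (d + 1)) (u : Fin (d + 1) → ℤ) (μ : Fin (d + 1)) (w t : Fin (d + 1) → ℤ),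
      mixFF κ (u + (Lc : ℤ) • t) μ (w + t) = shiftK (-((Lc : ℤ) • t)) (mixFF κ u μ w))
    (j : ℕ) (μ : Fin (d + 1)) (y : Fin (d + 1) → ℤ) (ν : Fin (d + 1)) (y' t : Fin (d + 1) → ℤ) :
    WrecAt d Lc ρ cE cVH cΛ cE₂ cB T vh₂S mixFF j μ (y + t) ν (y' + t) = shiftK (-((Lc : ℤ) • t)) (WrecAt d Lc ρ cE cVH cΛ cE₂ cB T vh₂S mixFF j μ y ν y') :=
  W2SymOfK_translate (N := Lc) (shiftK_coDressKBmAt_KInvStep (d := d) ρ j) (SpureRecAt_translate ρ hLc cE cVH cΛ j)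
    (M1At_translate (Lc := Lc) ρ cΛ j) (T2RecAt_translate ρ cE cVH cΛ cE₂ cB T vh₂S mixFF hLc hBt hmixt j) (M2Of_translate (Lc := Lc) hmixt j) μ y ν y' t

end W

/-! ## §4 The W-data package and the W-instantiated recursive wall literal -/

section Package

variable {Lc : ℕ} [NeZero Lc] (hLc : 1 ≤ Lc) {r : Fin (d + 1) → ℕ} (hr : r ∈ box (d + 1) Lc) (cE cVH cΛ cE₂ cB : ℝ)
  (T : Fin 4 → Fin 4 → Fin 4 → Fin 4 → ℝ)
  {vh₂S : Fin (d + 1) → (Fin (d + 1) → ℤ) → Fin (d + 1) → (Fin (d + 1) → ℤ) → MKer (d + 1) (Fib d)}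
  (hB : ∃ C δ : ℝ, 0 < δ ∧ LocStencil₂ vh₂S C δ)
  {mixFF : Fin (d + 1) → (Fin (d + 1) → ℤ) → Fin (d + 1) → (Fin (d + 1) → ℤ) → MKer (d + 1) (Fib d)}
  (hmix : ∃ C δ : ℝ, 0 < δ ∧ LocStencilFM Lc mixFF C δ)

/-- [folklore] The packaged localisation CONSTANT of `WrecAt … j` (`Classical.choose`). -/
def CwRecOf (j : ℕ) : ℝ := (vertexFamily₂_WrecAt' cE cVH cΛ cE₂ cB T vh₂S mixFF hLc hr hB hmix j).choose

/-- [folklore] The packaged localisation RATE of `WrecAt … j`. -/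
def δwRecOf (j : ℕ) : ℝ := (vertexFamily₂_WrecAt' cE cVH cΛ cE₂ cB T vh₂S mixFF hLc hr hB hmix j).choose_spec.choose

/-- [folklore] The packaged rate is positive. -/
theorem δwRecOf_pos (j : ℕ) : 0 < δwRecOf hLc hr cE cVH cΛ cE₂ cB T hB hmix j :=
  (vertexFamily₂_WrecAt' cE cVH cΛ cE₂ cB T vh₂S mixFF hLc hr hB hmix j).choose_spec.choose_spec.1

/-- [folklore] **THE (hW) BINDER OF `JsRecBmAtOf`, DISCHARGED FOR THE W-LITERAL.** -/
theorem WrecAt_loc₂ (j : ℕ) :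
    VertexFamily₂ (WrecAt d Lc (toSite r) cE cVH cΛ cE₂ cB T vh₂S mixFF j) Lc (CwRecOf hLc hr cE cVH cΛ cE₂ cB T hB hmix j)
      (δwRecOf hLc hr cE cVH cΛ cE₂ cB T hB hmix j) :=
  (vertexFamily₂_WrecAt' cE cVH cΛ cE₂ cB T vh₂S mixFF hLc hr hB hmix j).choose_spec.choose_spec.2

/-- [our object, wall-literal candidate v2.26-W] **THE RECURSIVE WALL FAMILY WITH ITS W-LITERAL INSTANTIATED**:
`JsRecWAtOf … := JsRecBmAtOf hLc hr cE cVH cΛ (WrecAt (toSite r) …) (CwRecOf …) (δwRecOf …) (δwRecOf_pos …) (WrecAt_loc₂ …)`. -/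
def JsRecWAtOf : ℕ → JetData d Lc :=
  JsRecBmAtOf (d := d) hLc hr cE cVH cΛ (WrecAt d Lc (toSite r) cE cVH cΛ cE₂ cB T vh₂S mixFF) (CwRecOf hLc hr cE cVH cΛ cE₂ cB T hB hmix)
    (δwRecOf hLc hr cE cVH cΛ cE₂ cB T hB hmix) (δwRecOf_pos hLc hr cE cVH cΛ cE₂ cB T hB hmix) (WrecAt_loc₂ hLc hr cE cVH cΛ cE₂ cB T hB hmix)

/-- [folklore] The W-instantiated family IS `JsRecBmAtOf` at `W := WrecAt` (`rfl`). -/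
theorem JsRecWAtOf_eq : JsRecWAtOf hLc hr cE cVH cΛ cE₂ cB T hB hmix =
    JsRecBmAtOf (d := d) hLc hr cE cVH cΛ (WrecAt d Lc (toSite r) cE cVH cΛ cE₂ cB T vh₂S mixFF) (CwRecOf hLc hr cE cVH cΛ cE₂ cB T hB hmix)
      (δwRecOf hLc hr cE cVH cΛ cE₂ cB T hB hmix) (δwRecOf_pos hLc hr cE cVH cΛ cE₂ cB T hB hmix) (WrecAt_loc₂ hLc hr cE cVH cΛ cE₂ cB T hB hmix) :=
  rfl

end Package

end Summit.QuantumFields.BalabanUV.Beta.SpineRooted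

end
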